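import Literature.MathematicalPhysics.KineticTheory.LangevinChainConfined
import Literature.MathematicalPhysics.KineticTheory.LangevinChainExpBound
import Literature.Probability.Process.KrylovBogoliubovCesaro
import HarnessLib

/-!
# Hairer–Mattingly 2009, Proposition 5.1: an invariant measure from a Lyapunov function with `L𝒱 → -∞`

Topic `Literature/MathematicalPhysics/KineticTheory` (trunk T-KINETIC). Hairer–Mattingly, *Slow
energy dissipation in anharmonic oscillator chains*, Comm. Pure Appl. Math. **62** (2009), Prop. 5.1:

> "Consider a SDE on `ℝⁿ` with smooth coefficients having global solutions and generator `L` and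
> such that the corresponding Markov semigroup is Feller. Suppose there exists a smooth function
> `𝒱 : ℝⁿ → ℝ₊` with the property that the level sets `{x : L𝒱(x) ≥ C}` are compact for every
> `C`, then the SDE has an invariant probability measure `μ`. Furthermore, `L𝒱` is integrable
> against `μ` and has mean zero."

and its proof: "applying Itô's formula to `𝒱` … `-∫₀ᵗ E L𝒱(x_s) ds ≤ 𝒱(x₀)` … the sequence of
measures `μ_t(A) = (1/t)∫₀ᵗ P_{x₀}(x_s ∈ A) ds` is tight. Hence the Kryloff–Bogoliouboff
construction guarantees the existence of an invariant measure". This is the half of the existence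
theorem for the three-oscillator chain (abstract; Thm 5.6 supplies `𝒱`) that is pure Markov-process
theory. We PROVE it for every object of the interface `LangevinChainSemigroup P N T_L T_R`
(`LangevinSemigroup.lean`) which is Feller and satisfies Dynkin's identity on `C²_c` — in
particular for the constructed semigroups `OscillatorChain.IsConfining.semigroup` of
`LangevinChainConfined.lean` (hence for the Hairer–Mattingly chain) — and for `𝒱 ∈ C²`, `𝒱 ≥ 0`
WITH COMPACT SUBLEVEL SETS (an assumption added to the printed hypotheses: the localisation by
stopping times of the printed proof is replaced by a spatial truncation of `𝒱`, which needs
properness; the `𝒱 ≥ cH^α - C` of Thm 5.6 is proper):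

* `sdeGenerator_comp` — the chain rule `L(F∘g) = F'(g) Lg + ½ F''(g) ∑_b (Dg·v_b)²` for the SDE
  generator of the model-free pipeline, hence `L(F∘g) ≤ F'(g) Lg` for concave `F`
  (`sdeGenerator_comp_le`);
* `linCutoff` — a `C²` concave cutoff `φ` with `φ(v) = v` on `(-∞,1]`, `φ` constant on `[2,∞)`,
  `0 ≤ φ' = χ ≤ 1` (the primitive of the smooth decreasing cutoff `smoothCutoff` of
  `LangevinChainExpBound.lean`);
* `LangevinChainSemigroup.lintegral_lyapunov_add_le` — **the drift inequality**: if
  `L𝒱 ≤ C - W` pointwise (`W ≥ 0` continuous, `C ≥ 0`) then for all `t, z`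
  `∫ 𝒱 dP_t(z,·) + ∫₀ᵗ ∫ W dP_s(z,·) ds ≤ 𝒱(z) + C t` (Lebesgue integrals): Dynkin for the
  truncations `R φ(𝒱/R) - R φ(2) ∈ C²_c`, `L(Rφ(𝒱/R)) ≤ χ(𝒱/R) L𝒱 ≤ C - χ(𝒱/R) W`, and Fatou;
* `LangevinChainSemigroup.exists_invariant_of_lyapunov_drift` — **Prop. 5.1** (with the moment
  bound `∫ W dμ ≤ 𝒱(z) + C`): the drift inequality gives the Cesàro bound
  `∫₀^{n+1} ∫ W dP_s(z,·) ds ≤ (n+1)(𝒱(z) + C)`, and the Cesàro Krylov–Bogoliubov theorem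
  `Literature.Probability.Process.MarkovSemigroup.exists_invariant_of_cesaro_bound`
  (`KrylovBogoliubovCesaro.lean`) with the coercive observable `W` concludes;
  `…exists_invariant_of_isCompact_superlevel_generator` is the printed formulation (compact
  superlevel sets `{L𝒱 ≥ C}`; conclusion: an invariant probability measure integrating `L𝒱`);
  `OscillatorChain.IsConfining.exists_invariant_of_lyapunov_drift` specialises to the constructed
  semigroup of a chain with confining potentials. The printed clause "has mean zero" is not
  formalised here.

## References

* M. Hairer, J. C. Mattingly, Comm. Pure Appl. Math. **62** (2009) 999–1032 (arXiv:0712.3884),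
  Prop. 5.1 and its proof.
* R. Khasminskii, *Stochastic Stability of Differential Equations* (2nd ed., 2012), Thm 3.7
  (supermartingale inequality for a Lyapunov function), §4.4.
* G. Da Prato, J. Zabczyk, *Ergodicity for infinite-dimensional systems* (1996), Cor. 3.1.2.
-/

noncomputable section

open MeasureTheory ProbabilityTheory Filter Topology Set intervalIntegral
open scoped NNReal ENNReal BoundedContinuousFunction

/-! ### The chain rule for the SDE generator -/

namespace Literature.MathematicalPhysics.KineticTheory

variable {E : Type*} [NormedAddCommGroup E] [NormedSpace ℝ E]

/-- `D(F∘g)(y) = F'(g(y)) Dg(y)` for `F : ℝ → ℝ` differentiable and `g` differentiable. [folklore] -/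
theorem fderiv_comp_eq_smul {F F' : ℝ → ℝ} (hF : ∀ u, HasDerivAt F (F' u) u) {g : E → ℝ}
    (hg : Differentiable ℝ g) :
    fderiv ℝ (fun y => F (g y)) = fun y => F' (g y) • fderiv ℝ g y :=
  funext fun y => ((hF (g y)).comp_hasFDerivAt y (hg y).hasFDerivAt).fderiv

/-- The derivative of `y ↦ D(F∘g)(y) = F'(g y) • Dg(y)`:
`F'(g y) • D²g(y) + (F''(g y) • Dg(y)) ⊗ Dg(y)` (`g ∈ C²`). [folklore] -/
theorem hasFDerivAt_fderiv_comp {F F' F'' : ℝ → ℝ} (hF : ∀ u, HasDerivAt F (F' u) u)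
    (hF' : ∀ u, HasDerivAt F' (F'' u) u) {g : E → ℝ} (hg : ContDiff ℝ 2 g) (y : E) :
    HasFDerivAt (fderiv ℝ (fun y => F (g y)))
      (F' (g y) • fderiv ℝ (fderiv ℝ g) y + (F'' (g y) • fderiv ℝ g y).smulRight (fderiv ℝ g y))
      y := by
  have hgd : Differentiable ℝ g := hg.differentiable (by norm_num)
  have hgd2 : Differentiable ℝ (fderiv ℝ g) :=
    (hg.fderiv_right (m := 1) (by norm_num)).differentiable (by norm_num)
  rw [fderiv_comp_eq_smul hF hgd]
  have ha : HasFDerivAt (fun y => F' (g y)) (F'' (g y) • fderiv ℝ g y) y :=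
    (hF' (g y)).comp_hasFDerivAt y (hgd y).hasFDerivAt
  exact ha.smul (hgd2 y).hasFDerivAt

/-- **Second derivative of a composition along two vectors**:
`D²(F∘g)(y)[v, w] = F'(g y) D²g(y)[v, w] + F''(g y) (Dg(y)·v)(Dg(y)·w)`. [folklore] -/
theorem fderiv_fderiv_comp_apply {F F' F'' : ℝ → ℝ} (hF : ∀ u, HasDerivAt F (F' u) u)
    (hF' : ∀ u, HasDerivAt F' (F'' u) u) {g : E → ℝ} (hg : ContDiff ℝ 2 g) (y v w : E) :
    fderiv ℝ (fderiv ℝ (fun y => F (g y))) y v w =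
      F' (g y) * fderiv ℝ (fderiv ℝ g) y v w + F'' (g y) * fderiv ℝ g y v * fderiv ℝ g y w := by
  rw [(hasFDerivAt_fderiv_comp hF hF' hg y).fderiv]
  simp only [FunLike.coe_add, Pi.add_apply, FunLike.coe_smul, Pi.smul_apply,
    ContinuousLinearMap.smulRight_apply, smul_eq_mul]

/-- **The chain rule for the SDE generator** `L = Df·Y + ½∑_b D²f[v_b, v_b]`:
`L(F∘g) = F'(g) Lg + ½ F''(g) ((Dg·v₁)² + (Dg·v₂)²)` for `g ∈ C²` and `F` twice differentiable.
[folklore] -/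
theorem sdeGenerator_comp (Y : E → E) (v₁ v₂ : E) {F F' F'' : ℝ → ℝ}
    (hF : ∀ u, HasDerivAt F (F' u) u) (hF' : ∀ u, HasDerivAt F' (F'' u) u) {g : E → ℝ}
    (hg : ContDiff ℝ 2 g) (y : E) :
    sdeGenerator Y v₁ v₂ (fun y => F (g y)) y =
      F' (g y) * sdeGenerator Y v₁ v₂ g y +
        (1 / 2) * F'' (g y) * (fderiv ℝ g y v₁ ^ 2 + fderiv ℝ g y v₂ ^ 2) := by
  have hgd : Differentiable ℝ g := hg.differentiable (by norm_num)
  rw [sdeGenerator_def, sdeGenerator_def, fderiv_fderiv_comp_apply hF hF' hg,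
    fderiv_fderiv_comp_apply hF hF' hg, fderiv_comp_eq_smul hF hgd]
  simp only [FunLike.coe_smul, Pi.smul_apply, smul_eq_mul]
  ring

/-- **`L(F∘g) ≤ F'(g) Lg` where `F'' ≤ 0`** (the second-order term of the chain rule is a
nonpositive multiple of a sum of squares). [folklore] -/
theorem sdeGenerator_comp_le (Y : E → E) (v₁ v₂ : E) {F F' F'' : ℝ → ℝ}
    (hF : ∀ u, HasDerivAt F (F' u) u) (hF' : ∀ u, HasDerivAt F' (F'' u) u) {g : E → ℝ}
    (hg : ContDiff ℝ 2 g) {y : E} (hy : F'' (g y) ≤ 0) :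
    sdeGenerator Y v₁ v₂ (fun y => F (g y)) y ≤ F' (g y) * sdeGenerator Y v₁ v₂ g y := by
  rw [sdeGenerator_comp Y v₁ v₂ hF hF' hg y]
  have h : 0 ≤ fderiv ℝ g y v₁ ^ 2 + fderiv ℝ g y v₂ ^ 2 := by positivity
  nlinarith [mul_nonneg_of_nonpos_of_nonpos hy (neg_nonpos.2 h)]

end Literature.MathematicalPhysics.KineticTheory

namespace Literature.MathematicalPhysics.KineticTheory.HeatConduction

open Literature.MathematicalPhysics.KineticTheory Literature.Probability.Process

/-! ### A `C²` concave cutoff: the primitive of `smoothCutoff` -/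

/-- `χ = smoothCutoff` is continuous. [folklore] -/
theorem continuous_smoothCutoff : Continuous smoothCutoff :=
  (contDiff_smoothCutoff (n := 0)).continuous

/-- The **linear cutoff** `φ(x) = ∫₀ˣ χ(s) ds`: `φ(x) = x` for `x ≤ 1`, `φ` constant on `[2, ∞)`,
`φ' = χ ∈ [0, 1]` decreasing — a concave `C^∞` function interpolating between the identity and a
constant. [folklore] -/
def linCutoff (x : ℝ) : ℝ :=
  ∫ s in (0 : ℝ)..x, smoothCutoff s

/-- `φ' = χ`. [folklore] -/
theorem hasDerivAt_linCutoff (x : ℝ) : HasDerivAt linCutoff (smoothCutoff x) x :=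
  (continuous_smoothCutoff.integral_hasStrictDerivAt 0 x).hasDerivAt

/-- `deriv φ = χ`. [folklore] -/
theorem deriv_linCutoff : deriv linCutoff = smoothCutoff :=
  funext fun x => (hasDerivAt_linCutoff x).deriv

/-- `φ` is differentiable. [folklore] -/
theorem differentiable_linCutoff : Differentiable ℝ linCutoff := fun x =>
  (hasDerivAt_linCutoff x).differentiableAt

/-- `φ ∈ C²` (all that Dynkin's identity needs). [folklore] -/
theorem contDiff_two_linCutoff : ContDiff ℝ 2 linCutoff := by
  rw [show (2 : WithTop ℕ∞) = 1 + 1 by norm_num, contDiff_succ_iff_deriv]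
  refine ⟨differentiable_linCutoff, fun h => absurd h (by simp), ?_⟩
  rw [deriv_linCutoff]
  exact (contDiff_smoothCutoff (n := ⊤)).of_le (mod_cast le_top)

/-- `φ(x) = x` for `x ≤ 1`. [folklore] -/
theorem linCutoff_of_le_one {x : ℝ} (hx : x ≤ 1) : linCutoff x = x := by
  unfold linCutoff
  have h : ∀ s ∈ Set.uIcc (0 : ℝ) x, smoothCutoff s = (fun _ => (1 : ℝ)) s := fun s hs => by
    refine smoothCutoff_of_le_one ?_
    rcases Set.mem_uIcc.1 hs with ⟨_, h1⟩ | ⟨_, h0⟩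
    · exact h1.trans hx
    · exact h0.trans zero_le_one
  rw [intervalIntegral.integral_congr h, intervalIntegral.integral_const, smul_eq_mul, mul_one]
  simp

/-- `φ(x) = φ(2)` for `x ≥ 2`. [folklore] -/
theorem linCutoff_of_two_le {x : ℝ} (hx : 2 ≤ x) : linCutoff x = linCutoff 2 := by
  unfold linCutoff
  have hint : ∀ a b : ℝ, IntervalIntegrable smoothCutoff volume a b := fun a b =>
    continuous_smoothCutoff.intervalIntegrable a b
  rw [← intervalIntegral.integral_add_adjacent_intervals (hint 0 2) (hint 2 x)]
  have h0 : ∫ s in (2 : ℝ)..x, smoothCutoff s = 0 := by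
    have h : ∀ s ∈ Set.uIcc (2 : ℝ) x, smoothCutoff s = (fun _ => (0 : ℝ)) s := fun s hs => by
      refine smoothCutoff_of_two_le ?_
      rw [Set.uIcc_of_le hx] at hs
      exact hs.1
    rw [intervalIntegral.integral_congr h, intervalIntegral.integral_const, smul_zero]
  rw [h0, add_zero]

/-- `φ(x) ≤ x` for `x ≥ 0` (`χ ≤ 1`). [folklore] -/
theorem linCutoff_le_self {x : ℝ} (hx : 0 ≤ x) : linCutoff x ≤ x := by
  unfold linCutoff
  calc ∫ s in (0 : ℝ)..x, smoothCutoff s ≤ ∫ _ in (0 : ℝ)..x, (1 : ℝ) :=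
        intervalIntegral.integral_mono_on hx (continuous_smoothCutoff.intervalIntegrable _ _)
          (by simp) fun s _ => smoothCutoff_le_one s
    _ = x := by simp

/-- `0 ≤ φ(x)` for `x ≥ 0` (`χ ≥ 0`). [folklore] -/
theorem linCutoff_nonneg {x : ℝ} (hx : 0 ≤ x) : 0 ≤ linCutoff x :=
  intervalIntegral.integral_nonneg hx fun s _ => smoothCutoff_nonneg s

/-- `φ(x) ≤ 2` for `x ≥ 0`. [folklore] -/
theorem linCutoff_le_two {x : ℝ} (hx : 0 ≤ x) : linCutoff x ≤ 2 := by
  rcases le_total x 2 with h | h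
  · exact (linCutoff_le_self hx).trans h
  · rw [linCutoff_of_two_le h]
    exact linCutoff_le_self (by norm_num)

/-- The scaled cutoff `v ↦ R φ(v/R)` has derivative `χ(v/R)` (`R ≠ 0`). [folklore] -/
theorem hasDerivAt_scaled_linCutoff {R : ℝ} (hR : R ≠ 0) (v : ℝ) :
    HasDerivAt (fun v => R * linCutoff (v / R)) (smoothCutoff (v / R)) v := by
  have h := ((hasDerivAt_linCutoff (v / R)).comp v ((hasDerivAt_id v).div_const R)).const_mul R
  refine h.congr_deriv ?_
  field_simp

/-- `v ↦ χ(v/R)` has derivative `χ'(v/R)/R`. [folklore] -/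
theorem hasDerivAt_scaled_smoothCutoff (R v : ℝ) :
    HasDerivAt (fun v => smoothCutoff (v / R)) (deriv smoothCutoff (v / R) / R) v := by
  have hd : Differentiable ℝ smoothCutoff := (contDiff_smoothCutoff (n := 1)).differentiable
    (by simp)
  have h := ((hd (v / R)).hasDerivAt).comp v ((hasDerivAt_id v).div_const R)
  refine h.congr_deriv ?_
  ring

/-! ### An additive Fatou inequality -/

/-- `liminf u + liminf v ≤ liminf (u + v)` in `ℝ≥0∞`. [folklore] -/
theorem add_liminf_le_liminf_add (u v : ℕ → ℝ≥0∞) :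
    liminf u atTop + liminf v atTop ≤ liminf (fun n => u n + v n) atTop := by
  refine le_of_forall_lt_imp_le_of_dense fun d hd => ?_
  by_cases hu : liminf u atTop = 0
  · rw [hu, zero_add] at hd
    refine le_liminf_of_le (h := ?_)
    filter_upwards [eventually_lt_of_lt_liminf hd] with n hn
    exact hn.le.trans le_add_self
  by_cases hv : liminf v atTop = 0
  · rw [hv, add_zero] at hd
    refine le_liminf_of_le (h := ?_)
    filter_upwards [eventually_lt_of_lt_liminf hd] with n hn
    exact hn.le.trans le_self_add
  obtain ⟨a, ha, b, hb, hab⟩ := ENNReal.exists_lt_add_of_lt_add hd hu hv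
  refine le_liminf_of_le (h := ?_)
  filter_upwards [eventually_lt_of_lt_liminf ha, eventually_lt_of_lt_liminf hb] with n hna hnb
  exact hab.le.trans (add_le_add hna.le hnb.le)

/-! ### The drift inequality for a `LangevinChainSemigroup` with Dynkin on `C²_c` -/

namespace LangevinChainSemigroup

variable {P : OscillatorChain} {N : ℕ} {T_L T_R : ℝ} (S : LangevinChainSemigroup P N T_L T_R)

/-- **The truncated drift inequality.** For `C¹` potentials, `N ≥ 1`, `γT_L, γT_R ≥ 0`, a Markov
semigroup `S` of the chain satisfying Dynkin's identity on `C²_c`, a proper `𝒱 ∈ C²`, `𝒱 ≥ 0`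
with `L𝒱 ≤ C - W` (`W ≥ 0` continuous, `C ≥ 0`) and every `R > 0`:
`∫ Rφ(𝒱/R) dP_t(z,·) + ∫₀ᵗ ∫ χ(𝒱/R) W dP_s(z,·) ds ≤ 𝒱(z) + C t`, from Dynkin's identity for
`Rφ(𝒱/R) - Rφ(2) ∈ C²_c` and `L(Rφ(𝒱/R)) ≤ χ(𝒱/R) L𝒱 ≤ C - χ(𝒱/R) W`.
[cite: HairerMattingly2009, Prop 5.1 (proof)] -/
theorem lintegral_truncLyapunov_add_le (hU : ContDiff ℝ 1 P.U) (hV : ContDiff ℝ 1 P.V) (hN : 0 < N)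
    (hL : 0 ≤ P.γ * T_L) (hR : 0 ≤ P.γ * T_R)
    (hdyn : ∀ f : PhaseSpace N → ℝ, ContDiff ℝ 2 f → HasCompactSupport f →
      ∀ (t : ℝ≥0) (z : PhaseSpace N), S.act t f z - f z =
        ∫ s in (0 : ℝ)..(t : ℝ), S.act s.toNNReal (P.generator N T_L T_R f) z)
    {𝒱 W : PhaseSpace N → ℝ} (h𝒱 : ContDiff ℝ 2 𝒱) (h𝒱0 : ∀ x, 0 ≤ 𝒱 x)
    (h𝒱c : ∀ R : ℝ, IsCompact {x | 𝒱 x ≤ R}) (hW : Continuous W) (hW0 : ∀ x, 0 ≤ W x)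
    {C : ℝ} (hC : 0 ≤ C) (hLV : ∀ x, P.generator N T_L T_R 𝒱 x ≤ C - W x)
    {R : ℝ} (hR0 : 0 < R) (t : ℝ≥0) (z : PhaseSpace N) :
    ∫⁻ y, ENNReal.ofReal (R * linCutoff (𝒱 y / R)) ∂(S.kernel t z) +
        ∫⁻ s in Ioc (0 : ℝ) t, ∫⁻ y, ENNReal.ofReal (smoothCutoff (𝒱 y / R) * W y)
          ∂(S.kernel s.toNNReal z) ≤
      ENNReal.ofReal (𝒱 z + C * t) := by
  -- the truncated Lyapunov function `g`, its compactly supported shift `u`, the truncated `W`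
  set Lgen := P.generator N T_L T_R with hLgen
  set g : PhaseSpace N → ℝ := fun y => R * linCutoff (𝒱 y / R) with hgdef
  set c : ℝ := R * linCutoff 2 with hcdef
  set u : PhaseSpace N → ℝ := fun y => g y - c with hudef
  set w : PhaseSpace N → ℝ := fun y => smoothCutoff (𝒱 y / R) * W y with hwdef
  have hRne : R ≠ 0 := hR0.ne'
  have h𝒱cont : Continuous 𝒱 := h𝒱.continuous
  have hg2 : ContDiff ℝ 2 g :=
    contDiff_const.mul (contDiff_two_linCutoff.comp (h𝒱.div_const R))
  have hu2 : ContDiff ℝ 2 u := hg2.sub contDiff_const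
  have hu_supp : HasCompactSupport u := by
    refine HasCompactSupport.intro (h𝒱c (2 * R)) fun x hx => ?_
    simp only [mem_setOf_eq, not_le] at hx
    have h2 : 2 ≤ 𝒱 x / R := by rw [le_div_iff₀ hR0]; linarith
    show R * linCutoff (𝒱 x / R) - R * linCutoff 2 = 0
    rw [linCutoff_of_two_le h2, sub_self]
  have hvR : ∀ y, 0 ≤ 𝒱 y / R := fun y => div_nonneg (h𝒱0 y) hR0.le
  have hg_nonneg : ∀ y, 0 ≤ g y := fun y => mul_nonneg hR0.le (linCutoff_nonneg (hvR y))
  have hg_le : ∀ y, g y ≤ 2 * R := fun y => by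
    have := mul_le_mul_of_nonneg_left (linCutoff_le_two (hvR y)) hR0.le
    show R * linCutoff (𝒱 y / R) ≤ 2 * R
    linarith
  have hg_leV : ∀ y, g y ≤ 𝒱 y := fun y => by
    have := mul_le_mul_of_nonneg_left (linCutoff_le_self (hvR y)) hR0.le
    have h1 : R * (𝒱 y / R) = 𝒱 y := by field_simp
    show R * linCutoff (𝒱 y / R) ≤ 𝒱 y
    linarith
  have hg_norm : ∀ y, ‖g y‖ ≤ 2 * R := fun y => by
    rw [Real.norm_of_nonneg (hg_nonneg y)]; exact hg_le y
  have hg_cont : Continuous g := hg2.continuous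
  have hχ0 : ∀ y, 0 ≤ smoothCutoff (𝒱 y / R) := fun y => smoothCutoff_nonneg _
  have hχ1 : ∀ y, smoothCutoff (𝒱 y / R) ≤ 1 := fun y => smoothCutoff_le_one _
  have hw_cont : Continuous w := (continuous_smoothCutoff.comp (h𝒱cont.div_const R)).mul hW
  have hw0 : ∀ y, 0 ≤ w y := fun y => mul_nonneg (hχ0 y) (hW0 y)
  obtain ⟨M, hM⟩ : ∃ M, ∀ y, ‖w y‖ ≤ M := by
    obtain ⟨M, hM⟩ := (h𝒱c (2 * R)).exists_bound_of_continuousOn hW.continuousOn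
    refine ⟨max M 0, fun y => ?_⟩
    rw [Real.norm_of_nonneg (hw0 y)]
    by_cases hy : 𝒱 y ≤ 2 * R
    · have h1 : ‖W y‖ ≤ M := hM y hy
      rw [Real.norm_of_nonneg (hW0 y)] at h1
      calc w y = smoothCutoff (𝒱 y / R) * W y := rfl
        _ ≤ 1 * W y := mul_le_mul_of_nonneg_right (hχ1 y) (hW0 y)
        _ ≤ max M 0 := by rw [one_mul]; exact h1.trans (le_max_left _ _)
    · have h2 : 2 ≤ 𝒱 y / R := by rw [le_div_iff₀ hR0]; linarith
      calc w y = smoothCutoff (𝒱 y / R) * W y := rfl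
        _ = 0 := by rw [smoothCutoff_of_two_le h2, zero_mul]
        _ ≤ max M 0 := le_max_right _ _
  -- `L g = L u` is bounded and continuous, and `L g ≤ C - w`
  have hLu : Lgen u = Lgen g := P.generator_sub_const N T_L T_R g c
  have hLg_cont : Continuous (Lgen g) := P.continuous_generator hU hV N T_L T_R hg2
  obtain ⟨CL, hCL⟩ : ∃ CL, ∀ x, ‖Lgen g x‖ ≤ CL := by
    obtain ⟨CL, hCL⟩ := P.exists_bound_generator hU hV N T_L T_R hu2 hu_supp
    exact ⟨CL, fun x => by rw [← hLu]; exact hCL x⟩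
  have hLg_le : ∀ x, Lgen g x ≤ C - w x := by
    intro x
    have hF : ∀ v, HasDerivAt (fun v => R * linCutoff (v / R)) (smoothCutoff (v / R)) v :=
      hasDerivAt_scaled_linCutoff hRne
    have hF' : ∀ v, HasDerivAt (fun v => smoothCutoff (v / R)) (deriv smoothCutoff (v / R) / R) v :=
      hasDerivAt_scaled_smoothCutoff R
    have hF'' : deriv smoothCutoff (𝒱 x / R) / R ≤ 0 :=
      div_nonpos_of_nonpos_of_nonneg (deriv_smoothCutoff_nonpos _) hR0.le
    have h1 : Lgen g x = sdeGenerator (P.drift N) (P.bathVecL N T_L) (P.bathVecR N T_R) g x := by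
      rw [P.sdeGenerator_drift_eq_generator hN hL hR hg2]
    have h2 : sdeGenerator (P.drift N) (P.bathVecL N T_L) (P.bathVecR N T_R) 𝒱 x = Lgen 𝒱 x := by
      rw [P.sdeGenerator_drift_eq_generator hN hL hR h𝒱]
    have h3 := sdeGenerator_comp_le (P.drift N) (P.bathVecL N T_L) (P.bathVecR N T_R) hF hF' h𝒱
      (y := x) hF''
    rw [h2] at h3
    rw [h1]
    refine h3.trans ?_
    have h4 : smoothCutoff (𝒱 x / R) * Lgen 𝒱 x ≤ smoothCutoff (𝒱 x / R) * (C - W x) :=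
      mul_le_mul_of_nonneg_left (hLV x) (hχ0 x)
    have h5 : smoothCutoff (𝒱 x / R) * C ≤ C := by
      have := mul_le_mul_of_nonneg_right (hχ1 x) hC
      linarith
    show smoothCutoff (𝒱 x / R) * Lgen 𝒱 x ≤ C - smoothCutoff (𝒱 x / R) * W x
    nlinarith
  -- the orbit maps `ψ(s) = P_s (L g)(z)`, `ω(s) = P_s w (z)`
  set ψ : ℝ → ℝ := fun s => S.act s.toNNReal (Lgen g) z with hψdef
  set ω' : ℝ → ℝ := fun s => S.act s.toNNReal w z with hωdef
  have hψ_meas : StronglyMeasurable ψ :=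
    (S.stronglyMeasurable_uncurry_act hLg_cont.stronglyMeasurable).comp_measurable
      (measurable_const.prodMk measurable_id)
  have hω_meas : StronglyMeasurable ω' :=
    (S.stronglyMeasurable_uncurry_act hw_cont.stronglyMeasurable).comp_measurable
      (measurable_const.prodMk measurable_id)
  have hψ_bound : ∀ s, ‖ψ s‖ ≤ CL := fun s => S.norm_act_le _ hCL z
  have hω_bound : ∀ s, ‖ω' s‖ ≤ M := fun s => S.norm_act_le _ hM z
  have hω_nonneg : ∀ s, 0 ≤ ω' s := fun s => integral_nonneg hw0
  have hψ_int : ∀ a b, IntervalIntegrable ψ volume a b := intervalIntegrable_of_norm_le hψ_meas hψ_bound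
  have hω_int : ∀ a b, IntervalIntegrable ω' volume a b := intervalIntegrable_of_norm_le hω_meas hω_bound
  have hψ_le : ∀ s, ψ s ≤ C - ω' s := fun s => by
    have hint_g : Integrable (Lgen g) (S.kernel s.toNNReal z) :=
      S.integrable_kernel_of_norm_le _ z hLg_cont hCL
    have hint_w : Integrable w (S.kernel s.toNNReal z) := S.integrable_kernel_of_norm_le _ z hw_cont hM
    have hC' : ∫ y, (C - w y) ∂(S.kernel s.toNNReal z) = C - ω' s := by
      rw [integral_sub (integrable_const C) hint_w]
      have : ∫ _ : PhaseSpace N, C ∂(S.kernel s.toNNReal z) = C := by simp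
      rw [this]
      rfl
    calc ψ s = ∫ y, Lgen g y ∂(S.kernel s.toNNReal z) := rfl
      _ ≤ ∫ y, (C - w y) ∂(S.kernel s.toNNReal z) :=
          integral_mono hint_g ((integrable_const C).sub hint_w) hLg_le
      _ = C - ω' s := hC'
  -- Dynkin's identity for `u` at time `t`
  have ht0 : (0 : ℝ) ≤ t := t.coe_nonneg
  have hdyn_g : S.act t g z - g z = ∫ s in (0 : ℝ)..(t : ℝ), ψ s := by
    have h := hdyn u hu2 hu_supp t z
    rw [hLu] at h
    have hint : S.act t u z = S.act t g z - c := by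
      show ∫ y, (g y - c) ∂(S.kernel t z) = (∫ y, g y ∂(S.kernel t z)) - c
      rw [integral_sub (S.integrable_kernel_of_norm_le _ z hg_cont hg_norm) (integrable_const c)]
      simp
    rw [hint] at h
    have hu0 : u z = g z - c := rfl
    rw [hu0] at h
    linarith
  -- the real-valued inequality
  have hreal : S.act t g z + ∫ s in (0 : ℝ)..(t : ℝ), ω' s ≤ 𝒱 z + C * t := by
    have h1 : ∫ s in (0 : ℝ)..(t : ℝ), ψ s ≤ ∫ s in (0 : ℝ)..(t : ℝ), (C - ω' s) :=
      intervalIntegral.integral_mono_on ht0 (hψ_int 0 t)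
        ((intervalIntegrable_const).sub (hω_int 0 t)) fun s _ => hψ_le s
    have h2 : ∫ s in (0 : ℝ)..(t : ℝ), (C - ω' s) = C * t - ∫ s in (0 : ℝ)..(t : ℝ), ω' s := by
      rw [intervalIntegral.integral_sub intervalIntegrable_const (hω_int 0 t),
        intervalIntegral.integral_const, smul_eq_mul, sub_zero, mul_comm]
    have h3 := hg_leV z
    linarith
  -- conversion to Lebesgue integrals
  have hA : ∫⁻ y, ENNReal.ofReal (g y) ∂(S.kernel t z) = ENNReal.ofReal (S.act t g z) := by
    rw [act_apply, ofReal_integral_eq_lintegral_ofReal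
      (S.integrable_kernel_of_norm_le _ z hg_cont hg_norm) (Eventually.of_forall hg_nonneg)]
  have hB : ∫⁻ s in Ioc (0 : ℝ) t, ∫⁻ y, ENNReal.ofReal (w y) ∂(S.kernel s.toNNReal z) =
      ENNReal.ofReal (∫ s in (0 : ℝ)..(t : ℝ), ω' s) := by
    have h1 : ∀ s, ∫⁻ y, ENNReal.ofReal (w y) ∂(S.kernel s.toNNReal z) = ENNReal.ofReal (ω' s) :=
      fun s => by
        show _ = ENNReal.ofReal (∫ y, w y ∂(S.kernel s.toNNReal z))
        rw [ofReal_integral_eq_lintegral_ofReal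
          (S.integrable_kernel_of_norm_le _ z hw_cont hM) (Eventually.of_forall hw0)]
    simp_rw [h1]
    have hint : Integrable ω' (volume.restrict (Ioc (0 : ℝ) t)) := (hω_int 0 t).1
    rw [intervalIntegral.integral_of_le ht0,
      ofReal_integral_eq_lintegral_ofReal hint (Eventually.of_forall hω_nonneg)]
  have hint_nonneg : 0 ≤ ∫ s in (0 : ℝ)..(t : ℝ), ω' s :=
    intervalIntegral.integral_nonneg ht0 fun s _ => hω_nonneg s
  have hact_nonneg : 0 ≤ S.act t g z := integral_nonneg hg_nonneg
  rw [hA, hB, ← ENNReal.ofReal_add hact_nonneg hint_nonneg]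
  exact ENNReal.ofReal_le_ofReal hreal

/-- **The drift inequality (Hairer–Mattingly 2009, proof of Prop. 5.1).** For `C¹` potentials,
`N ≥ 1`, `γT_L, γT_R ≥ 0`, a Markov semigroup `S` of the chain (interface `LangevinChainSemigroup`)
satisfying Dynkin's identity on `C²_c`, and a proper `𝒱 ∈ C²`, `𝒱 ≥ 0` with `L𝒱 ≤ C - W`
pointwise (`W ≥ 0` continuous, `C ≥ 0`):
`∫ 𝒱 dP_t(z, ·) + ∫₀ᵗ ∫ W dP_s(z, ·) ds ≤ 𝒱(z) + C t` for all `t ≥ 0`, `z` (Lebesgue integrals)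
— the printed "`E𝒱(x_t) + ∫₀ᵗ E(-L𝒱)(x_s) ds ≤ 𝒱(x₀)`" with the localisation replaced by the
truncations of `lintegral_truncLyapunov_add_le` and Fatou's lemma (`R = n + 1 → ∞`).
[cite: HairerMattingly2009, Prop 5.1 (proof)] -/
theorem lintegral_lyapunov_add_le (hU : ContDiff ℝ 1 P.U) (hV : ContDiff ℝ 1 P.V) (hN : 0 < N)
    (hL : 0 ≤ P.γ * T_L) (hR : 0 ≤ P.γ * T_R)
    (hdyn : ∀ f : PhaseSpace N → ℝ, ContDiff ℝ 2 f → HasCompactSupport f →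
      ∀ (t : ℝ≥0) (z : PhaseSpace N), S.act t f z - f z =
        ∫ s in (0 : ℝ)..(t : ℝ), S.act s.toNNReal (P.generator N T_L T_R f) z)
    {𝒱 W : PhaseSpace N → ℝ} (h𝒱 : ContDiff ℝ 2 𝒱) (h𝒱0 : ∀ x, 0 ≤ 𝒱 x)
    (h𝒱c : ∀ R : ℝ, IsCompact {x | 𝒱 x ≤ R}) (hW : Continuous W) (hW0 : ∀ x, 0 ≤ W x)
    {C : ℝ} (hC : 0 ≤ C) (hLV : ∀ x, P.generator N T_L T_R 𝒱 x ≤ C - W x)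
    (t : ℝ≥0) (z : PhaseSpace N) :
    ∫⁻ y, ENNReal.ofReal (𝒱 y) ∂(S.kernel t z) +
        ∫⁻ s in Ioc (0 : ℝ) t, ∫⁻ y, ENNReal.ofReal (W y) ∂(S.kernel s.toNNReal z) ≤
      ENNReal.ofReal (𝒱 z + C * t) := by
  have h𝒱cont : Continuous 𝒱 := h𝒱.continuous
  -- the truncations along `R = n + 1`
  set g : ℕ → PhaseSpace N → ℝ≥0∞ := fun n y =>
    ENNReal.ofReal (((n : ℝ) + 1) * linCutoff (𝒱 y / ((n : ℝ) + 1))) with hgdef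
  set w : ℕ → PhaseSpace N → ℝ≥0∞ := fun n y =>
    ENNReal.ofReal (smoothCutoff (𝒱 y / ((n : ℝ) + 1)) * W y) with hwdef
  have hg_meas : ∀ n, Measurable (g n) := fun n =>
    ENNReal.measurable_ofReal.comp
      (continuous_const.mul (contDiff_two_linCutoff.continuous.comp
        (h𝒱cont.div_const _))).measurable
  have hw_meas : ∀ n, Measurable (w n) := fun n =>
    ENNReal.measurable_ofReal.comp
      ((continuous_smoothCutoff.comp (h𝒱cont.div_const _)).mul hW).measurable
  -- pointwise: the truncations are eventually equal to `𝒱`, `W`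
  have hev : ∀ y, ∀ᶠ n : ℕ in atTop, 𝒱 y / ((n : ℝ) + 1) ≤ 1 := fun y => by
    refine (eventually_ge_atTop ⌈𝒱 y⌉₊).mono fun n hn => ?_
    have h1 : 𝒱 y ≤ (n : ℝ) + 1 := by
      have := Nat.le_ceil (𝒱 y)
      have hn' : (⌈𝒱 y⌉₊ : ℝ) ≤ n := by exact_mod_cast hn
      linarith
    rw [div_le_one (by positivity)]
    exact h1
  have hg_tendsto : ∀ y, Tendsto (fun n => g n y) atTop (𝓝 (ENNReal.ofReal (𝒱 y))) := fun y => by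
    refine (tendsto_const_nhds (x := ENNReal.ofReal (𝒱 y))).congr' ?_
    filter_upwards [hev y] with n hn
    simp only [hgdef]
    rw [linCutoff_of_le_one hn, mul_div_cancel₀ _ (by positivity)]
  have hw_tendsto : ∀ y, Tendsto (fun n => w n y) atTop (𝓝 (ENNReal.ofReal (W y))) := fun y => by
    refine (tendsto_const_nhds (x := ENNReal.ofReal (W y))).congr' ?_
    filter_upwards [hev y] with n hn
    simp only [hwdef]
    rw [smoothCutoff_of_le_one hn, one_mul]
  -- Fatou for the first term
  have hA : ∫⁻ y, ENNReal.ofReal (𝒱 y) ∂(S.kernel t z) ≤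
      liminf (fun n => ∫⁻ y, g n y ∂(S.kernel t z)) atTop := by
    calc ∫⁻ y, ENNReal.ofReal (𝒱 y) ∂(S.kernel t z)
        = ∫⁻ y, liminf (fun n => g n y) atTop ∂(S.kernel t z) :=
          lintegral_congr fun y => ((hg_tendsto y).liminf_eq).symm
      _ ≤ liminf (fun n => ∫⁻ y, g n y ∂(S.kernel t z)) atTop := lintegral_liminf_le hg_meas
  -- Fatou (twice) for the second term
  have hΦ_meas : ∀ n, Measurable fun s : ℝ => ∫⁻ y, w n y ∂(S.kernel s.toNNReal z) := fun n =>
    (Measure.measurable_lintegral (hw_meas n)).comp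
      (S.measurable_kernel.comp (measurable_real_toNNReal.prodMk measurable_const))
  have hB : ∫⁻ s in Ioc (0 : ℝ) t, ∫⁻ y, ENNReal.ofReal (W y) ∂(S.kernel s.toNNReal z) ≤
      liminf (fun n => ∫⁻ s in Ioc (0 : ℝ) t, ∫⁻ y, w n y ∂(S.kernel s.toNNReal z)) atTop := by
    calc ∫⁻ s in Ioc (0 : ℝ) t, ∫⁻ y, ENNReal.ofReal (W y) ∂(S.kernel s.toNNReal z)
        ≤ ∫⁻ s in Ioc (0 : ℝ) t, liminf (fun n => ∫⁻ y, w n y ∂(S.kernel s.toNNReal z)) atTop := by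
          refine lintegral_mono fun s => ?_
          calc ∫⁻ y, ENNReal.ofReal (W y) ∂(S.kernel s.toNNReal z)
              = ∫⁻ y, liminf (fun n => w n y) atTop ∂(S.kernel s.toNNReal z) :=
                lintegral_congr fun y => ((hw_tendsto y).liminf_eq).symm
            _ ≤ liminf (fun n => ∫⁻ y, w n y ∂(S.kernel s.toNNReal z)) atTop :=
                lintegral_liminf_le hw_meas
      _ ≤ liminf (fun n => ∫⁻ s in Ioc (0 : ℝ) t, ∫⁻ y, w n y ∂(S.kernel s.toNNReal z)) atTop :=
          lintegral_liminf_le hΦ_meas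
  -- the truncated inequalities and the additive Fatou inequality
  have hkey : ∀ n : ℕ, (∫⁻ y, g n y ∂(S.kernel t z)) +
      ∫⁻ s in Ioc (0 : ℝ) t, ∫⁻ y, w n y ∂(S.kernel s.toNNReal z) ≤ ENNReal.ofReal (𝒱 z + C * t) :=
    fun n => S.lintegral_truncLyapunov_add_le hU hV hN hL hR hdyn h𝒱 h𝒱0 h𝒱c hW hW0 hC hLV
      (R := (n : ℝ) + 1) (by positivity) t z
  calc _ ≤ liminf (fun n => ∫⁻ y, g n y ∂(S.kernel t z)) atTop +
        liminf (fun n => ∫⁻ s in Ioc (0 : ℝ) t, ∫⁻ y, w n y ∂(S.kernel s.toNNReal z)) atTop :=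
        add_le_add hA hB
    _ ≤ liminf (fun n => (∫⁻ y, g n y ∂(S.kernel t z)) +
        ∫⁻ s in Ioc (0 : ℝ) t, ∫⁻ y, w n y ∂(S.kernel s.toNNReal z)) atTop :=
        add_liminf_le_liminf_add _ _
    _ ≤ ENNReal.ofReal (𝒱 z + C * t) :=
        liminf_le_of_frequently_le' (Eventually.of_forall hkey).frequently

/-! ### Proposition 5.1: an invariant probability measure -/

/-- **Hairer–Mattingly 2009, Proposition 5.1 (drift form), PROVED for the interface.** For `C¹`
potentials, `N ≥ 1`, `γT_L, γT_R ≥ 0`, a FELLER Markov semigroup `S` of the chain satisfying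
Dynkin's identity on `C²_c`, and a proper `𝒱 ∈ C²`, `𝒱 ≥ 0` with `L𝒱 ≤ C - W` for a
continuous `W ≥ 0` with compact sublevel sets (`C ≥ 0`): there is an invariant probability
measure `μ` of `S`, and `∫ W dμ ≤ 𝒱(z) + C` (any `z`). Proof: the drift inequality gives the
Cesàro bounds `∫₀^{n+1} ∫ W dP_s(z,·) ds ≤ (n+1)(𝒱(z) + C)`, and the Cesàro Krylov–Bogoliubov
theorem (`Literature.Probability.Process.MarkovSemigroup.exists_invariant_of_cesaro_bound`)
applies to the coercive observable `W` ("the sequence of measures `μ_t` … is tight. Hence the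
Kryloff–Bogoliouboff construction guarantees the existence of an invariant measure").
[cite: HairerMattingly2009, Prop 5.1] -/
theorem exists_invariant_of_lyapunov_drift (hU : ContDiff ℝ 1 P.U) (hV : ContDiff ℝ 1 P.V)
    (hN : 0 < N) (hL : 0 ≤ P.γ * T_L) (hR : 0 ≤ P.γ * T_R)
    (hfeller : ∀ (t : ℝ≥0) (g : PhaseSpace N →ᵇ ℝ), Continuous (S.act t g))
    (hdyn : ∀ f : PhaseSpace N → ℝ, ContDiff ℝ 2 f → HasCompactSupport f →
      ∀ (t : ℝ≥0) (z : PhaseSpace N), S.act t f z - f z =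
        ∫ s in (0 : ℝ)..(t : ℝ), S.act s.toNNReal (P.generator N T_L T_R f) z)
    {𝒱 W : PhaseSpace N → ℝ} (h𝒱 : ContDiff ℝ 2 𝒱) (h𝒱0 : ∀ x, 0 ≤ 𝒱 x)
    (h𝒱c : ∀ R : ℝ, IsCompact {x | 𝒱 x ≤ R}) (hW : Continuous W) (hW0 : ∀ x, 0 ≤ W x)
    (hWc : ∀ R : ℝ, IsCompact {x | W x ≤ R})
    {C : ℝ} (hC : 0 ≤ C) (hLV : ∀ x, P.generator N T_L T_R 𝒱 x ≤ C - W x) (z : PhaseSpace N) :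
    ∃ μ : Measure (PhaseSpace N), IsProbabilityMeasure μ ∧ S.IsInvariant μ ∧
      ∫⁻ x, ENNReal.ofReal (W x) ∂μ ≤ ENNReal.ofReal (𝒱 z + C) := by
  set W' : PhaseSpace N → ℝ≥0 := fun x => (W x).toNNReal with hW'def
  have hW'c : Continuous W' := continuous_real_toNNReal.comp hW
  have hW'cpt : ∀ R : ℝ≥0, IsCompact {x | W' x ≤ R} := fun R => by
    have h : {x | W' x ≤ R} = {x | W x ≤ (R : ℝ)} := by
      ext x
      simp only [mem_setOf_eq, hW'def, Real.toNNReal_le_iff_le_coe]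
    rw [h]
    exact hWc R
  have hcoe : ∀ x, (W' x : ℝ≥0∞) = ENNReal.ofReal (W x) := fun x => rfl
  have hC' : ∀ n : ℕ, ∫⁻ s in Ioc (0 : ℝ) (n + 1), ∫⁻ y, (W' y : ℝ≥0∞) ∂(S.kernel s.toNNReal z) ≤
      ((n : ℝ≥0∞) + 1) * ENNReal.ofReal (𝒱 z + C) := by
    intro n
    have h := S.lintegral_lyapunov_add_le hU hV hN hL hR hdyn h𝒱 h𝒱0 h𝒱c hW hW0 hC hLV
      ((n : ℝ≥0) + 1) z
    simp only [hcoe]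
    have h1 : (((n : ℝ≥0) + 1 : ℝ≥0) : ℝ) = (n : ℝ) + 1 := by push_cast; ring
    rw [h1] at h
    refine (le_of_add_le_right h).trans ?_
    have h2 : 𝒱 z + C * ((n : ℝ) + 1) ≤ ((n : ℝ) + 1) * (𝒱 z + C) := by
      have : 0 ≤ (n : ℝ) * 𝒱 z := mul_nonneg (Nat.cast_nonneg n) (h𝒱0 z)
      nlinarith
    calc ENNReal.ofReal (𝒱 z + C * ((n : ℝ) + 1))
        ≤ ENNReal.ofReal (((n : ℝ) + 1) * (𝒱 z + C)) := ENNReal.ofReal_le_ofReal h2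
      _ = ((n : ℝ≥0∞) + 1) * ENNReal.ofReal (𝒱 z + C) := by
          rw [ENNReal.ofReal_mul (by positivity)]
          congr 1
          rw [ENNReal.ofReal_add (Nat.cast_nonneg n) zero_le_one, ENNReal.ofReal_natCast,
            ENNReal.ofReal_one]
  obtain ⟨μ, hμ, hinv, hb⟩ := MarkovSemigroup.exists_invariant_of_cesaro_bound S.kernel
    S.kernel_add S.measurable_kernel (fun t g => hfeller t g) W' hW'c hW'cpt
    ENNReal.ofReal_ne_top z hC'
  refine ⟨μ, hμ, hinv, ?_⟩
  simpa only [hcoe] using hb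

/-- **Hairer–Mattingly 2009, Proposition 5.1, in the printed formulation** (compact superlevel sets
`{x : L𝒱(x) ≥ C}` for every `C`; with properness of `𝒱` added, see the module docstring): for the
interface as above, such a `𝒱` yields an invariant probability measure `μ` of `S` against which
`L𝒱` is integrable ("Furthermore, `L𝒱` is integrable against `μ`"). Reduction to the drift form:
`L𝒱` is continuous, hence bounded by some `K ≥ 0` on the compact set `{L𝒱 ≥ 0}`, so `L𝒱 ≤ K`
everywhere and `W = K - L𝒱 ≥ 0` is continuous with compact sublevel sets. The printed "has mean
zero" is not formalised. [cite: HairerMattingly2009, Prop 5.1] -/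
theorem exists_invariant_of_isCompact_superlevel_generator (hU : ContDiff ℝ 1 P.U)
    (hV : ContDiff ℝ 1 P.V) (hN : 0 < N) (hL : 0 ≤ P.γ * T_L) (hR : 0 ≤ P.γ * T_R)
    (hfeller : ∀ (t : ℝ≥0) (g : PhaseSpace N →ᵇ ℝ), Continuous (S.act t g))
    (hdyn : ∀ f : PhaseSpace N → ℝ, ContDiff ℝ 2 f → HasCompactSupport f →
      ∀ (t : ℝ≥0) (z : PhaseSpace N), S.act t f z - f z =
        ∫ s in (0 : ℝ)..(t : ℝ), S.act s.toNNReal (P.generator N T_L T_R f) z)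
    {𝒱 : PhaseSpace N → ℝ} (h𝒱 : ContDiff ℝ 2 𝒱) (h𝒱0 : ∀ x, 0 ≤ 𝒱 x)
    (h𝒱c : ∀ R : ℝ, IsCompact {x | 𝒱 x ≤ R})
    (hLc : ∀ C : ℝ, IsCompact {x | C ≤ P.generator N T_L T_R 𝒱 x}) :
    ∃ μ : Measure (PhaseSpace N), IsProbabilityMeasure μ ∧ S.IsInvariant μ ∧
      Integrable (P.generator N T_L T_R 𝒱) μ := by
  set Lv := P.generator N T_L T_R 𝒱 with hLvdef
  have hLv_cont : Continuous Lv := P.continuous_generator hU hV N T_L T_R h𝒱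
  -- `L𝒱 ≤ K` everywhere
  obtain ⟨K, hK0, hK⟩ : ∃ K, 0 ≤ K ∧ ∀ x, Lv x ≤ K := by
    obtain ⟨K, hK⟩ := (hLc 0).exists_bound_of_continuousOn hLv_cont.continuousOn
    refine ⟨max K 0, le_max_right _ _, fun x => ?_⟩
    by_cases hx : 0 ≤ Lv x
    · exact ((le_abs_self _).trans ((Real.norm_eq_abs _) ▸ hK x hx)).trans (le_max_left _ _)
    · exact (not_le.1 hx).le.trans (le_max_right _ _)
  set W : PhaseSpace N → ℝ := fun x => K - Lv x with hWdef
  have hW : Continuous W := continuous_const.sub hLv_cont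
  have hW0 : ∀ x, 0 ≤ W x := fun x => sub_nonneg.2 (hK x)
  have hWc : ∀ R : ℝ, IsCompact {x | W x ≤ R} := fun R => by
    have h : {x | W x ≤ R} = {x | K - R ≤ Lv x} := by
      ext x; simp only [mem_setOf_eq, hWdef]; constructor <;> intro h <;> linarith
    rw [h]
    exact hLc _
  have hLV : ∀ x, Lv x ≤ K - W x := fun x => by simp only [hWdef]; linarith
  obtain ⟨z⟩ : Nonempty (PhaseSpace N) := ⟨0⟩
  obtain ⟨μ, hμ, hinv, hb⟩ := S.exists_invariant_of_lyapunov_drift hU hV hN hL hR hfeller hdyn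
    h𝒱 h𝒱0 h𝒱c hW hW0 hWc hK0 hLV z
  refine ⟨μ, hμ, hinv, ?_⟩
  -- `W` is integrable, hence so is `L𝒱 = K - W`
  have hW_int : Integrable W μ := by
    refine ⟨hW.aestronglyMeasurable, ?_⟩
    rw [hasFiniteIntegral_iff_ofReal (Eventually.of_forall hW0)]
    exact hb.trans_lt ENNReal.ofReal_lt_top
  have hLv_eq : Lv = fun x => K - W x := by funext x; simp only [hWdef]; ring
  rw [hLv_eq]
  exact (integrable_const K).sub hW_int

end LangevinChainSemigroup

/-! ### The constructed semigroups of chains with confining potentials -/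

namespace OscillatorChain.IsConfining

variable {P : OscillatorChain} {N : ℕ} {T_L T_R : ℝ}

/-- **Proposition 5.1 for the constructed semigroup of a chain with confining potentials**
(`LangevinChainConfined.lean`): for `N ≥ 1`, `T_L, T_R ≥ 0`, a proper `𝒱 ∈ C²`, `𝒱 ≥ 0` with
`L𝒱 ≤ C - W` (`W ≥ 0` continuous with compact sublevel sets, `C ≥ 0`), the transition semigroup
`hP.semigroup` has an invariant probability measure `μ` with `∫ W dμ ≤ 𝒱(z) + C`. The Feller
property and Dynkin's identity on `C²_c` are theorems for this semigroup, so no hypothesis on `S`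
remains. [cite: HairerMattingly2009, Prop 5.1] -/
theorem exists_invariant_of_lyapunov_drift (hP : P.IsConfining) (hN : 0 < N) (hTL : 0 ≤ T_L)
    (hTR : 0 ≤ T_R) {𝒱 W : PhaseSpace N → ℝ} (h𝒱 : ContDiff ℝ 2 𝒱) (h𝒱0 : ∀ x, 0 ≤ 𝒱 x)
    (h𝒱c : ∀ R : ℝ, IsCompact {x | 𝒱 x ≤ R}) (hW : Continuous W) (hW0 : ∀ x, 0 ≤ W x)
    (hWc : ∀ R : ℝ, IsCompact {x | W x ≤ R})
    {C : ℝ} (hC : 0 ≤ C) (hLV : ∀ x, P.generator N T_L T_R 𝒱 x ≤ C - W x) (z : PhaseSpace N) :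
    ∃ μ : Measure (PhaseSpace N), IsProbabilityMeasure μ ∧
      (hP.semigroup N T_L T_R hN hTL hTR).IsInvariant μ ∧
        ∫⁻ x, ENNReal.ofReal (W x) ∂μ ≤ ENNReal.ofReal (𝒱 z + C) :=
  (hP.semigroup N T_L T_R hN hTL hTR).exists_invariant_of_lyapunov_drift
    (hP.contDiff_U.of_le (by norm_num)) (hP.contDiff_V.of_le (by norm_num)) hN
    (mul_nonneg hP.γ_nonneg hTL) (mul_nonneg hP.γ_nonneg hTR)
    (hP.continuous_act_semigroup N T_L T_R hN hTL hTR)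
    (fun _ hf hf' t z => hP.semigroup_dynkin_two N T_L T_R hN hTL hTR hf hf' t z)
    h𝒱 h𝒱0 h𝒱c hW hW0 hWc hC hLV z

/-- **The drift inequality for the constructed semigroup**:
`∫ 𝒱 dP_t(z,·) + ∫₀ᵗ ∫ W dP_s(z,·) ds ≤ 𝒱(z) + C t`. [cite: HairerMattingly2009, Prop 5.1 (proof)] -/
theorem lintegral_lyapunov_add_le (hP : P.IsConfining) (hN : 0 < N) (hTL : 0 ≤ T_L)
    (hTR : 0 ≤ T_R) {𝒱 W : PhaseSpace N → ℝ} (h𝒱 : ContDiff ℝ 2 𝒱) (h𝒱0 : ∀ x, 0 ≤ 𝒱 x)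
    (h𝒱c : ∀ R : ℝ, IsCompact {x | 𝒱 x ≤ R}) (hW : Continuous W) (hW0 : ∀ x, 0 ≤ W x)
    {C : ℝ} (hC : 0 ≤ C) (hLV : ∀ x, P.generator N T_L T_R 𝒱 x ≤ C - W x) (t : ℝ≥0)
    (z : PhaseSpace N) :
    ∫⁻ y, ENNReal.ofReal (𝒱 y) ∂((hP.semigroup N T_L T_R hN hTL hTR).kernel t z) +
        ∫⁻ s in Ioc (0 : ℝ) t, ∫⁻ y, ENNReal.ofReal (W y)
          ∂((hP.semigroup N T_L T_R hN hTL hTR).kernel s.toNNReal z) ≤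
      ENNReal.ofReal (𝒱 z + C * t) :=
  (hP.semigroup N T_L T_R hN hTL hTR).lintegral_lyapunov_add_le
    (hP.contDiff_U.of_le (by norm_num)) (hP.contDiff_V.of_le (by norm_num)) hN
    (mul_nonneg hP.γ_nonneg hTL) (mul_nonneg hP.γ_nonneg hTR)
    (fun _ hf hf' t z => hP.semigroup_dynkin_two N T_L T_R hN hTL hTR hf hf' t z)
    h𝒱 h𝒱0 h𝒱c hW hW0 hC hLV t z

end OscillatorChain.IsConfining

end Literature.MathematicalPhysics.KineticTheory.HeatConduction

end
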